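/-
Copyright (c) 2026 the pub-hodgecm-mathlib formalisation cell (harness21).  Prover seat hodgecm-mathlib-K2E3-p04 (g2), Track B ∕ K2-LIT
(build stream 29), h413 = `stmt-HodgeConjecture-24833`, line `K2_E3_EllipticInputs`, unit U4 «Keys» — road I («Keys' own road»: the rank-one intertwining
integral), brick I-4a «THE JUNCTION: REDUCIBILITY ON THE UNRAMIFIED LINE ⟺ THE COUNTER-INTERTWINER KILLS THE SPHERICAL VECTOR».  2026-09-04.
-/
import Summits.HodgeConjecture.HodgeConjecture.Theorems.K2E3SphericalCFunctionMacdonald            -- ★ (this base, g2): Macdonald's `c_w(χ)` at inert ∕ tame-ramified `v ∤ 2` (brings the whole road I chain, ★ I-2a `intertwiningMap_sphericalVector_eq_smul`)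
import Summits.HodgeConjecture.HodgeConjecture.Theorems.K2E3PSRegularReducibleCompZero             -- ★ p855058 U4-a (this base, g0): regular + reducible ⇒ every `B ∘ A = 0`
import Summits.HodgeConjecture.HodgeConjecture.Theorems.K2E3IntertwinerCompositionScalar           -- ★ p854977 U4-e (K2E3-p08): `B ∘ A = γ·id`
import Summits.HodgeConjecture.HodgeConjecture.Theorems.F0P3ReducibleOfIntertwiningCompositionZero  -- ★ `cmPrincipalSeries_reducible_of_forall_comp_eq_zero` (every `B ∘ A = 0` ⇒ reducible)
import HarnessLib

/-!
# h413 ∕ Track B «K2-LIT», unit U4 «Keys», road I brick I-4a: THE JUNCTION OF ROADS I AND II — for a REGULAR `χ` with `K_v`-spherical `i_G(χ)`, `i_G(wχ)`: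
# `i_G(χ)` reducible ⟺ `(A f_K)(1)·(B f'_K)(1) = 0` for all intertwiners `A : i(χ) → i(wχ)`, `B : i(wχ) → i(χ)`; and at a non-dyadic place with `χ` contracting,
# ⟺ `(B f'_K)(1) = 0` for every `B` (Macdonald: `(J f_K)(1) = c_w(χ) ≠ 0`)   [Casselman1995 Thm. 6.6.2; Keys1984 §3, §7; Rogawski1990 §12.2]

Cell `pub/hodgecm-mathlib`, crux H413 = `stmt-HodgeConjecture-24833` (lane `--supports … --as helper`), route HCCMUnconditional; dealer K2E3-plan (23:40:43Z (d) «U4-f stays with Road I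
(K2E3-p04) ∕ Road II (K2E3-p05)»; U4Keys ED. 4: U4-f is the ONE open socket of the unit).  THEOREMS ONLY (0 def ∕ 0 instance ∕ 0 notation ∕ 0 sorry); ★-only imports.  MEMO
`K2/K2E3-p04/g2/MEMO-ROAD-I-v2.K2E3-p04-g2.md` §2 (N2).  This is where the two roads to U4-f `sig_K2E3KeysThmTwoContracting` MEET on the unramified line: road I's Harish-Chandra
`c`-function (★ Macdonald) removes the `A`-side factor, leaving the single number `(B f'_K)(1)` — the counter-intertwiner on the spherical vector, i.e. the CONTINUED
`c`-function `c_w(wχ)` — which the Iwahori-level computation of road II (★ `K2E3ParahoricReducibilityCriterion`, II-2a∕b, II-3) or a Hecke-algebra brick evaluates.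

THE MATHEMATICS.  `G = U(Φ₃)(L⁺_v)`, `v` non-split, `χ = (χ₁, χ₂)` continuous and REGULAR (`wχ ≠ χ`), `f_K ∈ i(χ)^{K_v}`, `f'_K ∈ i(wχ)^{K_v}` with `f_K(1) = f'_K(1) = 1`.  Every
`G`-map between the two principal series is evaluation at `1` on the spherical line (★ I-2a `intertwiningMap_sphericalVector_eq_smul`: `A f_K = (A f_K)(1) f'_K`,
`B f'_K = (B f'_K)(1) f_K`), and `B ∘ A = γ·id` (★ U4-e); evaluating `γ f_K = B(A f_K)` gives **`γ = (A f_K)(1)·(B f'_K)(1)`** (§1 `comp_scalar_eq_eval_mul_eval`).  Since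
«reducible ⟺ every `B ∘ A = 0`» (★ U4-a ∕ ★ `cmPrincipalSeries_reducible_of_forall_comp_eq_zero`, [Casselman1995, Thm. 6.6.2]):
* §2 **`reducible_iff_forall_eval_mul_eval_eq_zero`** — `i(χ)` reducible ⟺ `∀ A B, (A f_K)(1)·(B f'_K)(1) = 0` (every non-split `v`, every regular `K_v`-spherical `χ`).
* §3 **`reducible_iff_forall_counterIntertwiner_eval_eq_zero_inert ∕ _ramified`** — at an inert ∕ tame-ramified `v ∤ 2`, `χ₂(−1) = 1`, `χ₁ = 1` on `𝒪_vˣ`, `|χ₁| = ‖·‖^s`, `s > 0`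
  (★ `K2E3SphericalCFunctionUnramifiedHypotheses` derives all three from «`χ` trivial on `T ∩ K_v`» + «contracting»): the intertwining integral `J` has `(J f_K)(1) = c_w(χ)·μ…`
  `= μ(B₁)(1 + z∕q_F)(1 − z∕q_F²)∕(1 − z²) ≠ 0` (resp. `μ(B₁)(1 − z∕q_F)∕(1 − z) ≠ 0`) for `|z| < 1`, hence **`i(χ)` reducible ⟺ `∀ B : i(wχ) → i(χ), (B f'_K)(1) = 0`**.
So Keys' Thm (2) on the contracting unramified line is EQUIVALENT to: «`(B f'_K)(1) = 0` iff `χ₁ ∈ {‖·‖_E, η‖·‖_E^{1∕2} (η(ϖ) = −1)}`» for the (one-dimensional space of) `B`.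

HONEST LABEL.  HC_CM is proved only modulo the 7 printed citations (2 remaining named inputs: hLiu418 = `stmt-HodgeConjecture-24832`, h413 = `stmt-HodgeConjecture-24833`) until
rung 0 closes; count-neutral (U4-f itself is NOT closed here: the value of `(B f'_K)(1)` is the remaining Iwahori-level input).

## References
* [Casselman1995] W. Casselman, *Introduction to the theory of admissible representations of `p`-adic reductive groups* (1995), Thm. 6.6.2 p. 66, §6.4 pp. 62–64.
* [Keys1984] D. Keys, *Principal series representations of special unitary groups over local fields*, Compositio Math. 51 (1984), §3 Thm. 1, §7 Thm (2).
* [Rogawski1990] J. D. Rogawski, *Automorphic Representations of Unitary Groups in Three Variables* (1990), §4.5 p. 45, §12.2 p. 173.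
* [CartierCorvallis1979] P. Cartier, *Representations of `p`-adic groups: a survey*, Proc. Symp. Pure Math. 33 (1979), §IV.1 (spherical vectors).
-/

set_option autoImplicit false
-- the mandated namespace repeats the single-problem summit's segment (`HodgeConjecture.HodgeConjecture`)
set_option linter.dupNamespace false

noncomputable section

open NumberField IsDedekindDomain MeasureTheory
open scoped Matrix NNReal ENNReal

open Literature.NumberTheory Literature.NumberTheory.Automorphic Literature.NumberTheory.Automorphic.UnitaryGroup
open Literature.NumberTheory.GaloisRepresentations Literature.NumberTheory.GaloisRepresentations.IsNonarchimedeanLocalField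

namespace Summit.HodgeConjecture.HodgeConjecture.Cruxes.H413.K2E3SphericalReducibilityJunction

variable (L : Type) [Field L] [NumberField L] [IsCMField L] (v : HeightOneSpectrum (𝓞 ↥(maximalRealSubfield L)))

/-! ## §1 The composition scalar on the spherical line: `γ = (A f_K)(1) · (B f'_K)(1)` -/

set_option synthInstance.maxHeartbeats 400000 in
set_option maxHeartbeats 8000000 in
-- statement∕proof over two `SmoothInd` carriers of ★ `cmPrincipalSeries` (class of ★ `K2E3IntertwiningIntegralSphericalLine.intertwiningMap_sphericalVector_eq_smul`)
/-- **`(B ∘ A) f_K = ((A f_K)(1)·(B f'_K)(1)) • f_K`** for `G`-maps `A : i(χ) → i(wχ)`, `B : i(wχ) → i(χ)` and spherical `f_K ∈ i(χ)^{K_v}`, `f'_K ∈ i(wχ)^{K_v}` with `f_K(1) = f'_K(1) = 1`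
(every finite non-split or split `v`): twice ★ `intertwiningMap_sphericalVector_eq_smul`. [cite: Casselman1995, §6.4 p. 63] [cite: CartierCorvallis1979, §IV.1] [cite: Keys1984, §3] -/
theorem comp_apply_sphericalVector (χ₁ : (LocalRing L v)ˣ →* ℂˣ) (χ₂ : ↥(normOneUnits (conjLocal L (IsCMField.complexConj L) v)) →* ℂˣ)
    (fK : haveI := locallyCompactSpace_cmBorelU L 3 v
      Representation.SmoothInd (cmBorelTriple L 3 v).P (Representation.twist (((Representation.trivial ℂ ↥(torusU (conjLocal L (IsCMField.complexConj L) v) (cmLocalForm L 3 v)) ℂ).twist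
        (cmTorusCharPair L v χ₁ χ₂)).comp (cmBorelTriple L 3 v).proj) (rootDeltaChar (cmBorelTriple L 3 v).P)))
    (hfK : haveI := locallyCompactSpace_cmBorelU L 3 v
      fK ∈ (Representation.smoothIndRep (cmBorelTriple L 3 v).P _).fixedPoints (cmLocalIntegralLevel L 3 (Matrix.of fun i j : Fin 3 => if i.val + j.val + 1 = 3 then (1 : L) else 0) v)) (hK1 : fK.toFun 1 = 1)
    (fK' : haveI := locallyCompactSpace_cmBorelU L 3 v
      Representation.SmoothInd (cmBorelTriple L 3 v).P (Representation.twist (((Representation.trivial ℂ ↥(torusU (conjLocal L (IsCMField.complexConj L) v) (cmLocalForm L 3 v)) ℂ).twist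
        (cmTorusCharPair L v (conjInvChar (conjLocal L (IsCMField.complexConj L) v) χ₁) χ₂)).comp (cmBorelTriple L 3 v).proj) (rootDeltaChar (cmBorelTriple L 3 v).P)))
    (hfK' : haveI := locallyCompactSpace_cmBorelU L 3 v
      fK' ∈ (Representation.smoothIndRep (cmBorelTriple L 3 v).P _).fixedPoints (cmLocalIntegralLevel L 3 (Matrix.of fun i j : Fin 3 => if i.val + j.val + 1 = 3 then (1 : L) else 0) v)) (hK'1 : fK'.toFun 1 = 1)
    (A : (cmPrincipalSeries L 3 v (cmTorusCharPair L v χ₁ χ₂)).IntertwiningMap (cmPrincipalSeries L 3 v (cmTorusCharPair L v (conjInvChar (conjLocal L (IsCMField.complexConj L) v) χ₁) χ₂)))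
    (B : (cmPrincipalSeries L 3 v (cmTorusCharPair L v (conjInvChar (conjLocal L (IsCMField.complexConj L) v) χ₁) χ₂)).IntertwiningMap (cmPrincipalSeries L 3 v (cmTorusCharPair L v χ₁ χ₂))) :
    (B.comp A) fK = ((A fK).toFun 1 * (B fK').toFun 1) • fK := by
  have hA := K2E3IntertwiningIntegralSphericalLine.intertwiningMap_sphericalVector_eq_smul L v _ _ A fK hfK fK' hfK' hK'1
  have hB := K2E3IntertwiningIntegralSphericalLine.intertwiningMap_sphericalVector_eq_smul L v _ _ B fK' hfK' fK hfK hK1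
  rw [Representation.IntertwiningMap.comp_apply]
  conv_lhs => rw [hA, map_smul, hB, smul_smul]

set_option synthInstance.maxHeartbeats 400000 in
set_option maxHeartbeats 8000000 in
-- statement∕proof over two `SmoothInd` carriers of ★ `cmPrincipalSeries` (class of ★ `K2E3IntertwinerCompositionScalar.intertwinerCompositionScalar`)
/-- **THE COMPOSITION SCALAR IS `(A f_K)(1)·(B f'_K)(1)`**: for REGULAR `χ` (`v` non-split, `χ₁, χ₂` continuous) `B ∘ A` acts on ALL of `i(χ)` as the scalar `(A f_K)(1)·(B f'_K)(1)` — it is a scalar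
`γ` by ★ U4-e (`End_G i(χ) = ℂ`), and `γ = γ·f_K(1) = ((B∘A) f_K)(1)` by §1. [cite: Casselman1995, §6.4 p. 63; Thm. 6.6.2] [cite: Keys1984, §3 Thm. 1] -/
theorem comp_apply_eq_eval_mul_eval_smul (hns : ∀ w : PlacesOver L v, IsCMField.complexConj L • w.1 = w.1) (χ₁ : (LocalRing L v)ˣ →* ℂˣ) (χ₂ : ↥(normOneUnits (conjLocal L (IsCMField.complexConj L) v)) →* ℂˣ) (h₁ : Continuous fun x => ((χ₁ x : ℂˣ) : ℂ)) (h₂ : Continuous fun x => ((χ₂ x : ℂˣ) : ℂ))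
    (hreg : cmTorusCharPair L v χ₁ χ₂ ≠ cmTorusCharPair L v (conjInvChar (conjLocal L (IsCMField.complexConj L) v) χ₁) χ₂)
    (fK : haveI := locallyCompactSpace_cmBorelU L 3 v
      Representation.SmoothInd (cmBorelTriple L 3 v).P (Representation.twist (((Representation.trivial ℂ ↥(torusU (conjLocal L (IsCMField.complexConj L) v) (cmLocalForm L 3 v)) ℂ).twist
        (cmTorusCharPair L v χ₁ χ₂)).comp (cmBorelTriple L 3 v).proj) (rootDeltaChar (cmBorelTriple L 3 v).P)))
    (hfK : haveI := locallyCompactSpace_cmBorelU L 3 v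
      fK ∈ (Representation.smoothIndRep (cmBorelTriple L 3 v).P _).fixedPoints (cmLocalIntegralLevel L 3 (Matrix.of fun i j : Fin 3 => if i.val + j.val + 1 = 3 then (1 : L) else 0) v)) (hK1 : fK.toFun 1 = 1)
    (fK' : haveI := locallyCompactSpace_cmBorelU L 3 v
      Representation.SmoothInd (cmBorelTriple L 3 v).P (Representation.twist (((Representation.trivial ℂ ↥(torusU (conjLocal L (IsCMField.complexConj L) v) (cmLocalForm L 3 v)) ℂ).twist
        (cmTorusCharPair L v (conjInvChar (conjLocal L (IsCMField.complexConj L) v) χ₁) χ₂)).comp (cmBorelTriple L 3 v).proj) (rootDeltaChar (cmBorelTriple L 3 v).P)))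
    (hfK' : haveI := locallyCompactSpace_cmBorelU L 3 v
      fK' ∈ (Representation.smoothIndRep (cmBorelTriple L 3 v).P _).fixedPoints (cmLocalIntegralLevel L 3 (Matrix.of fun i j : Fin 3 => if i.val + j.val + 1 = 3 then (1 : L) else 0) v)) (hK'1 : fK'.toFun 1 = 1)
    (A : (cmPrincipalSeries L 3 v (cmTorusCharPair L v χ₁ χ₂)).IntertwiningMap (cmPrincipalSeries L 3 v (cmTorusCharPair L v (conjInvChar (conjLocal L (IsCMField.complexConj L) v) χ₁) χ₂)))
    (B : (cmPrincipalSeries L 3 v (cmTorusCharPair L v (conjInvChar (conjLocal L (IsCMField.complexConj L) v) χ₁) χ₂)).IntertwiningMap (cmPrincipalSeries L 3 v (cmTorusCharPair L v χ₁ χ₂)))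
    (x : haveI := locallyCompactSpace_cmBorelU L 3 v
      Representation.SmoothInd (cmBorelTriple L 3 v).P (Representation.twist (((Representation.trivial ℂ ↥(torusU (conjLocal L (IsCMField.complexConj L) v) (cmLocalForm L 3 v)) ℂ).twist
        (cmTorusCharPair L v χ₁ χ₂)).comp (cmBorelTriple L 3 v).proj) (rootDeltaChar (cmBorelTriple L 3 v).P))) :
    (B.comp A) x = ((A fK).toFun 1 * (B fK').toFun 1) • x := by
  obtain ⟨c, hc⟩ := K2E3IntertwinerCompositionScalar.intertwinerCompositionScalar L v hns χ₁ χ₂ h₁ h₂ hreg A B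
  have hcK : c • fK = ((A fK).toFun 1 * (B fK').toFun 1) • fK := by
    rw [← hc fK, Representation.IntertwiningMap.toLinearMap_apply, comp_apply_sphericalVector L v χ₁ χ₂ fK hfK hK1 fK' hfK' hK'1 A B]
  have hc1 : c = (A fK).toFun 1 * (B fK').toFun 1 := by
    have h := congrArg (fun f : haveI := locallyCompactSpace_cmBorelU L 3 v
      Representation.SmoothInd (cmBorelTriple L 3 v).P (Representation.twist (((Representation.trivial ℂ ↥(torusU (conjLocal L (IsCMField.complexConj L) v) (cmLocalForm L 3 v)) ℂ).twist
        (cmTorusCharPair L v χ₁ χ₂)).comp (cmBorelTriple L 3 v).proj) (rootDeltaChar (cmBorelTriple L 3 v).P)) => f.toFun 1) hcK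
    simp only [Representation.SmoothInd.toFun_smul, Pi.smul_apply, hK1, smul_eq_mul, mul_one] at h
    exact h
  rw [← hc1, ← hc x, Representation.IntertwiningMap.toLinearMap_apply]

/-! ## §2 Reducible ⟺ every `(A f_K)(1)·(B f'_K)(1)` vanishes -/

set_option synthInstance.maxHeartbeats 400000 in
set_option maxHeartbeats 8000000 in
-- statement∕proof over two `SmoothInd` carriers of ★ `cmPrincipalSeries` (class of ★ `F0P3ReducibleOfIntertwiningCompositionZero.cmPrincipalSeries_reducible_of_forall_comp_eq_zero`)
/-- **`i_G(χ)` IS REDUCIBLE ⟺ `(A f_K)(1)·(B f'_K)(1) = 0` FOR ALL `A : i(χ) → i(wχ)`, `B : i(wχ) → i(χ)`** (`v` non-split, `χ` regular continuous, `f_K`, `f'_K` spherical with value `1` at `1`):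
«reducible ⟺ every `B ∘ A = 0`» (★ U4-a p855058 ∕ ★ `cmPrincipalSeries_reducible_of_forall_comp_eq_zero`) and `B ∘ A = (A f_K)(1)(B f'_K)(1)·id` (§1).
[cite: Casselman1995, Thm. 6.6.2 p. 66] [cite: Keys1984, §7 Theorem; §3] [cite: Rogawski1990, §12.2 p. 173] -/
theorem reducible_iff_forall_eval_mul_eval_eq_zero (hns : ∀ w : PlacesOver L v, IsCMField.complexConj L • w.1 = w.1) (χ₁ : (LocalRing L v)ˣ →* ℂˣ) (χ₂ : ↥(normOneUnits (conjLocal L (IsCMField.complexConj L) v)) →* ℂˣ) (h₁ : Continuous fun x => ((χ₁ x : ℂˣ) : ℂ)) (h₂ : Continuous fun x => ((χ₂ x : ℂˣ) : ℂ))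
    (hreg : cmTorusCharPair L v χ₁ χ₂ ≠ cmTorusCharPair L v (conjInvChar (conjLocal L (IsCMField.complexConj L) v) χ₁) χ₂)
    (fK : haveI := locallyCompactSpace_cmBorelU L 3 v
      Representation.SmoothInd (cmBorelTriple L 3 v).P (Representation.twist (((Representation.trivial ℂ ↥(torusU (conjLocal L (IsCMField.complexConj L) v) (cmLocalForm L 3 v)) ℂ).twist
        (cmTorusCharPair L v χ₁ χ₂)).comp (cmBorelTriple L 3 v).proj) (rootDeltaChar (cmBorelTriple L 3 v).P)))
    (hfK : haveI := locallyCompactSpace_cmBorelU L 3 v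
      fK ∈ (Representation.smoothIndRep (cmBorelTriple L 3 v).P _).fixedPoints (cmLocalIntegralLevel L 3 (Matrix.of fun i j : Fin 3 => if i.val + j.val + 1 = 3 then (1 : L) else 0) v)) (hK1 : fK.toFun 1 = 1)
    (fK' : haveI := locallyCompactSpace_cmBorelU L 3 v
      Representation.SmoothInd (cmBorelTriple L 3 v).P (Representation.twist (((Representation.trivial ℂ ↥(torusU (conjLocal L (IsCMField.complexConj L) v) (cmLocalForm L 3 v)) ℂ).twist
        (cmTorusCharPair L v (conjInvChar (conjLocal L (IsCMField.complexConj L) v) χ₁) χ₂)).comp (cmBorelTriple L 3 v).proj) (rootDeltaChar (cmBorelTriple L 3 v).P)))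
    (hfK' : haveI := locallyCompactSpace_cmBorelU L 3 v
      fK' ∈ (Representation.smoothIndRep (cmBorelTriple L 3 v).P _).fixedPoints (cmLocalIntegralLevel L 3 (Matrix.of fun i j : Fin 3 => if i.val + j.val + 1 = 3 then (1 : L) else 0) v)) (hK'1 : fK'.toFun 1 = 1) :
    (∃ N : Subrepresentation (cmPrincipalSeries L 3 v (cmTorusCharPair L v χ₁ χ₂)), N ≠ ⊥ ∧ N ≠ ⊤) ↔
      ∀ (A : (cmPrincipalSeries L 3 v (cmTorusCharPair L v χ₁ χ₂)).IntertwiningMap (cmPrincipalSeries L 3 v (cmTorusCharPair L v (conjInvChar (conjLocal L (IsCMField.complexConj L) v) χ₁) χ₂)))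
        (B : (cmPrincipalSeries L 3 v (cmTorusCharPair L v (conjInvChar (conjLocal L (IsCMField.complexConj L) v) χ₁) χ₂)).IntertwiningMap (cmPrincipalSeries L 3 v (cmTorusCharPair L v χ₁ χ₂))), (A fK).toFun 1 * (B fK').toFun 1 = 0 := by
  constructor
  · intro hred A B
    have h0 := K2E3PSRegularReducibleCompZero.PSRegularReducibleCompZero L v hns χ₁ χ₂ h₁ h₂ hreg hred A B
    have h := comp_apply_sphericalVector L v χ₁ χ₂ fK hfK hK1 fK' hfK' hK'1 A B
    rw [h0, Representation.IntertwiningMap.coe_zero, Pi.zero_apply] at h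
    have h1 := congrArg (fun f : haveI := locallyCompactSpace_cmBorelU L 3 v
      Representation.SmoothInd (cmBorelTriple L 3 v).P (Representation.twist (((Representation.trivial ℂ ↥(torusU (conjLocal L (IsCMField.complexConj L) v) (cmLocalForm L 3 v)) ℂ).twist
        (cmTorusCharPair L v χ₁ χ₂)).comp (cmBorelTriple L 3 v).proj) (rootDeltaChar (cmBorelTriple L 3 v).P)) => f.toFun 1) h
    simp only [Representation.SmoothInd.toFun_smul, Pi.smul_apply, hK1, smul_eq_mul, mul_one, Representation.SmoothInd.toFun_zero, Pi.zero_apply] at h1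
    exact h1.symm
  · intro h
    refine F0P3ReducibleOfIntertwiningCompositionZero.cmPrincipalSeries_reducible_of_forall_comp_eq_zero L v hns χ₁ χ₂ h₁ h₂ hreg fun A B => ?_
    refine DFunLike.ext _ _ fun x => ?_
    rw [comp_apply_eq_eval_mul_eval_smul L v hns χ₁ χ₂ h₁ h₂ hreg fK hfK hK1 fK' hfK' hK'1 A B x, h A B, zero_smul, Representation.IntertwiningMap.coe_zero, Pi.zero_apply]

/-! ## §3 At a non-dyadic place with `χ` contracting: reducible ⟺ `(B f'_K)(1) = 0` for every counter-intertwiner `B` -/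

set_option synthInstance.maxHeartbeats 400000 in
set_option maxHeartbeats 4000000 in
-- the matrix-group carrier of `N(L⁺_v)` (class of ★ `K2E3SphericalCFunctionShellExpansion.height_le_one_or_eq_inv_pow`)
/-- **`0 < μ(B₁)`**: the unit height ball `B₁ = {‖u₀₂‖ ≤ 1} = N(𝒪_v)` is OPEN (`= {‖u₀₂‖ < q}` by the shell partition ★ `height_le_one_or_eq_inv_pow`, the height is continuous ★) and contains `1`,
so every Haar measure gives it positive (and finite, ★ `measure_heightBall_lt_top`) mass. `v` non-split. [cite: Casselman1995, §6.4 p. 63] [cite: Rogawski1990, §1.10 p. 9] -/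
theorem measureReal_heightBall_one_pos (hns : ∀ w : PlacesOver L v, IsCMField.complexConj L • w.1 = w.1) (ϖ : (LocalRing L v)ˣ) (hϖ : ∀ w : PlacesOver L v, Valued.v ((ϖ : LocalRing L v) w) = WithZero.exp (-1 : ℤ))
    [MeasurableSpace ↥(cmBorelTriple L 3 v).N] [BorelSpace ↥(cmBorelTriple L 3 v).N] (μ : Measure ↥(cmBorelTriple L 3 v).N) [μ.IsHaarMeasure] :
    0 < μ.real {u : ↥(cmBorelTriple L 3 v).N | (((∏ w' : PlacesOver L v, normAbs (w'.1.adicCompletion L) ((((((u : ↥(unitaryGroupOfForm (conjLocal L (IsCMField.complexConj L) v) (cmLocalForm L 3 v)))) : GL (Fin 3) (LocalRing L v)) : Matrix (Fin 3) (Fin 3) (LocalRing L v)) 0 2) w')) : ℝ≥0) : ℝ) ≤ 1} := by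
  haveI := locallyCompactSpace_cmBorelU L 3 v
  have ha0 : 0 < ((unitModulusChar (LocalRing L v) ϖ : ℝ≥0) : ℝ) := NNReal.coe_pos.2 distribHaarChar_pos
  have ha1 : ((unitModulusChar (LocalRing L v) ϖ : ℝ≥0) : ℝ) < 1 := by exact_mod_cast K2E3SphericalCFunctionShellExpansion.unitModulusChar_uniformizer_lt_one L v hns ϖ hϖ
  have hq : 1 < (((unitModulusChar (LocalRing L v) ϖ : ℝ≥0) : ℝ)⁻¹) := one_lt_inv_iff₀.2 ⟨ha0, ha1⟩
  have hopen : IsOpen {u : ↥(cmBorelTriple L 3 v).N | (((∏ w' : PlacesOver L v, normAbs (w'.1.adicCompletion L) ((((((u : ↥(unitaryGroupOfForm (conjLocal L (IsCMField.complexConj L) v) (cmLocalForm L 3 v)))) : GL (Fin 3) (LocalRing L v)) : Matrix (Fin 3) (Fin 3) (LocalRing L v)) 0 2) w')) : ℝ≥0) : ℝ) ≤ 1} := by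
    have heq : {u : ↥(cmBorelTriple L 3 v).N | (((∏ w' : PlacesOver L v, normAbs (w'.1.adicCompletion L) ((((((u : ↥(unitaryGroupOfForm (conjLocal L (IsCMField.complexConj L) v) (cmLocalForm L 3 v)))) : GL (Fin 3) (LocalRing L v)) : Matrix (Fin 3) (Fin 3) (LocalRing L v)) 0 2) w')) : ℝ≥0) : ℝ) ≤ 1} =
        (fun u : ↥(cmBorelTriple L 3 v).N => (((∏ w' : PlacesOver L v, normAbs (w'.1.adicCompletion L) ((((((u : ↥(unitaryGroupOfForm (conjLocal L (IsCMField.complexConj L) v) (cmLocalForm L 3 v)))) : GL (Fin 3) (LocalRing L v)) : Matrix (Fin 3) (Fin 3) (LocalRing L v)) 0 2) w')) : ℝ≥0) : ℝ)) ⁻¹' Set.Iio (((unitModulusChar (LocalRing L v) ϖ : ℝ≥0) : ℝ)⁻¹) := by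
      ext u
      rw [Set.mem_setOf_eq, Set.mem_preimage, Set.mem_Iio]
      refine ⟨fun h => h.trans_lt hq, fun h => ?_⟩
      rcases K2E3SphericalCFunctionShellExpansion.height_le_one_or_eq_inv_pow L v hns ϖ hϖ u with h1 | ⟨n, hn⟩
      · exact h1
      · exfalso
        rw [hn] at h
        exact absurd h (not_lt.2 (le_self_pow₀ hq.le (Nat.succ_ne_zero n)))
    rw [heq]
    exact (F0P3cStCharTSKeys3AnnulusDock.continuous_norm_entry L v).isOpen_preimage _ isOpen_Iio
  obtain ⟨w⟩ : Nonempty (PlacesOver L v) := inferInstance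
  have hmem : (1 : ↥(cmBorelTriple L 3 v).N) ∈ {u : ↥(cmBorelTriple L 3 v).N | (((∏ w' : PlacesOver L v, normAbs (w'.1.adicCompletion L) ((((((u : ↥(unitaryGroupOfForm (conjLocal L (IsCMField.complexConj L) v) (cmLocalForm L 3 v)))) : GL (Fin 3) (LocalRing L v)) : Matrix (Fin 3) (Fin 3) (LocalRing L v)) 0 2) w')) : ℝ≥0) : ℝ) ≤ 1} := by
    have h0 : (((((1 : ↥(cmBorelTriple L 3 v).N) : ↥(unitaryGroupOfForm (conjLocal L (IsCMField.complexConj L) v) (cmLocalForm L 3 v)))) : GL (Fin 3) (LocalRing L v)) : Matrix (Fin 3) (Fin 3) (LocalRing L v)) 0 2 = 0 := by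
      rw [OneMemClass.coe_one, OneMemClass.coe_one, Units.val_one, Matrix.one_apply_ne (by decide)]
    rw [Set.mem_setOf_eq, (F0P3cStCharTSLocalRingNormDictionary.prod_normAbs_eq_zero_iff L v w (hns w) _).2 h0, NNReal.coe_zero]
    exact zero_le_one
  rw [measureReal_def, ENNReal.toReal_pos_iff]
  exact ⟨hopen.measure_pos μ ⟨1, hmem⟩, K2E3HeightBallVolumeScaling.measure_heightBall_lt_top L v hns μ 1⟩


set_option synthInstance.maxHeartbeats 400000 in
set_option maxHeartbeats 8000000 in
-- statement∕proof over two `SmoothInd` carriers of ★ `cmPrincipalSeries` (class of ★ `K2E3SphericalCFunctionMacdonald.exists_intertwiningIntegral_sphericalVector_eq_macdonald_smul`)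
/-- **THE JUNCTION, INERT PLACE.**  `v` non-split, inert place (`v ∤ 2`), `w₀` of matrix `Φ₃`, `μ` Haar on `N(L⁺_v)`, `ϖ` a uniformiser unit; `χ₁, χ₂` continuous, `χ₂(−1) = 1`, `χ₁ = 1` on `𝒪_vˣ`,
`|χ₁| = ‖·‖^s` with `s > 0` (so `χ` is regular and `|z| < 1`, `z = χ₁(ϖ)`); `f_K ∈ i(χ)^{K_v}`, `f'_K ∈ i(wχ)^{K_v}` with `f_K(1) = f'_K(1) = 1`.  Then
**`i_G(χ)` is reducible ⟺ `(B f'_K)(1) = 0` for every `G`-map `B : i(wχ) → i(χ)`**: in §2 take `A = J(w, χ)`, whose `(J f_K)(1) = c_w(χ)·μ(B₁)`-value is Macdonald's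
(★ `K2E3SphericalCFunctionMacdonald`), non-zero on `|z| < 1` (§3 `measureReal_heightBall_one_pos` and the explicit factors).  Keys' Theorem (2) on this line thus reads:
«`(B f'_K)(1) = 0` exactly when `χ₁ = ‖·‖_E` or `χ₁ = η‖·‖_E^{1∕2}` (`η(ϖ) = −1`)» — the counter-intertwiner on the spherical vector = the continued `c_w(wχ)`, an Iwahori-level number.
[cite: Casselman1995, Thm. 6.6.2 p. 66; §6.4] [cite: Keys1984, §7 Thm (2); §3] [cite: Rogawski1990, §4.5 p. 45; §12.2 p. 173] -/
theorem reducible_iff_forall_counterIntertwiner_eval_eq_zero_inert (hns : ∀ w : PlacesOver L v, IsCMField.complexConj L • w.1 = w.1) (w : PlacesOver L v)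
    (hunrL : Algebra.IsUnramifiedIn (𝓞 L) v.asIdeal) (h2w : Valued.v (2 : w.1.adicCompletion L) = 1)
    (χ₁ : (LocalRing L v)ˣ →* ℂˣ) (χ₂ : ↥(normOneUnits (conjLocal L (IsCMField.complexConj L) v)) →* ℂˣ) (h₁ : Continuous fun x => ((χ₁ x : ℂˣ) : ℂ)) (h₂ : Continuous fun x => ((χ₂ x : ℂˣ) : ℂ)) (hχ₂ : χ₂ ⟨-1, F0P3cStCharTSBigCellFactorisation.neg_one_mem_normOneUnits (conjLocal L (IsCMField.complexConj L) v)⟩ = 1)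
    (hunr : ∀ u ∈ (Submonoid.pi Set.univ (fun w : PlacesOver L v => (w.1.adicCompletionIntegers L).toSubring.toSubmonoid)).units, χ₁ u = 1) {s : ℝ} (hs : 0 < s)
    (hχ₁ : ∀ x : (LocalRing L v)ˣ, ‖((χ₁ x : ℂˣ) : ℂ)‖ = ((unitModulusChar (LocalRing L v) x : ℝ≥0) : ℝ) ^ s)
    (ϖ : (LocalRing L v)ˣ) (hϖ : ∀ w : PlacesOver L v, Valued.v ((ϖ : LocalRing L v) w) = WithZero.exp (-1 : ℤ))
    (w₀ : ↥(unitaryGroupOfForm (conjLocal L (IsCMField.complexConj L) v) (cmLocalForm L 3 v))) (hw₀ : Units.val (w₀ : GL (Fin 3) (LocalRing L v)) = cmLocalForm L 3 v)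
    [MeasurableSpace ↥(cmBorelTriple L 3 v).N] [BorelSpace ↥(cmBorelTriple L 3 v).N] (μ : Measure ↥(cmBorelTriple L 3 v).N) [μ.IsHaarMeasure]
    (fK : haveI := locallyCompactSpace_cmBorelU L 3 v
      Representation.SmoothInd (cmBorelTriple L 3 v).P (Representation.twist (((Representation.trivial ℂ ↥(torusU (conjLocal L (IsCMField.complexConj L) v) (cmLocalForm L 3 v)) ℂ).twist
        (cmTorusCharPair L v χ₁ χ₂)).comp (cmBorelTriple L 3 v).proj) (rootDeltaChar (cmBorelTriple L 3 v).P)))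
    (hfK : haveI := locallyCompactSpace_cmBorelU L 3 v
      fK ∈ (Representation.smoothIndRep (cmBorelTriple L 3 v).P _).fixedPoints (cmLocalIntegralLevel L 3 (Matrix.of fun i j : Fin 3 => if i.val + j.val + 1 = 3 then (1 : L) else 0) v)) (hK1 : fK.toFun 1 = 1)
    (fK' : haveI := locallyCompactSpace_cmBorelU L 3 v
      Representation.SmoothInd (cmBorelTriple L 3 v).P (Representation.twist (((Representation.trivial ℂ ↥(torusU (conjLocal L (IsCMField.complexConj L) v) (cmLocalForm L 3 v)) ℂ).twist
        (cmTorusCharPair L v (conjInvChar (conjLocal L (IsCMField.complexConj L) v) χ₁) χ₂)).comp (cmBorelTriple L 3 v).proj) (rootDeltaChar (cmBorelTriple L 3 v).P)))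
    (hfK' : haveI := locallyCompactSpace_cmBorelU L 3 v
      fK' ∈ (Representation.smoothIndRep (cmBorelTriple L 3 v).P _).fixedPoints (cmLocalIntegralLevel L 3 (Matrix.of fun i j : Fin 3 => if i.val + j.val + 1 = 3 then (1 : L) else 0) v)) (hK'1 : fK'.toFun 1 = 1) :
    (∃ N : Subrepresentation (cmPrincipalSeries L 3 v (cmTorusCharPair L v χ₁ χ₂)), N ≠ ⊥ ∧ N ≠ ⊤) ↔
      ∀ (B : (cmPrincipalSeries L 3 v (cmTorusCharPair L v (conjInvChar (conjLocal L (IsCMField.complexConj L) v) χ₁) χ₂)).IntertwiningMap (cmPrincipalSeries L 3 v (cmTorusCharPair L v χ₁ χ₂))), (B fK').toFun 1 = 0 := by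
  have ha0 : 0 < ((unitModulusChar (LocalRing L v) ϖ : ℝ≥0) : ℝ) := NNReal.coe_pos.2 distribHaarChar_pos
  have ha1 : ((unitModulusChar (LocalRing L v) ϖ : ℝ≥0) : ℝ) < 1 := by exact_mod_cast K2E3SphericalCFunctionShellExpansion.unitModulusChar_uniformizer_lt_one L v hns ϖ hϖ
  have hz : ‖((χ₁ ϖ : ℂˣ) : ℂ)‖ < 1 := by rw [hχ₁ ϖ]; exact Real.rpow_lt_one ha0.le ha1 hs
  have hreg := K2E3NonUnitaryCharacterDichotomy.cmTorusCharPair_ne_weyl_of_exists_norm_ne_one L v hns χ₁ χ₂ h₁ ⟨ϖ, hz.ne⟩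
  -- the intertwining integral and its Macdonald value on `f_K`
  obtain ⟨J, -, -, hJK⟩ := K2E3SphericalCFunctionMacdonald.exists_intertwiningIntegral_sphericalVector_eq_macdonald_smul L v hns w hunrL h2w χ₁ χ₂ h₁ h₂ hχ₂ hunr hs hχ₁
    ϖ hϖ w₀ hw₀ μ fK hfK fK' hfK' hK'1
  have hq1 : (1 : ℝ) ≤ ((Ideal.absNorm v.asIdeal : ℕ) : ℝ) := by exact_mod_cast Nat.one_le_iff_ne_zero.2 fun h => v.ne_bot (Ideal.absNorm_eq_zero_iff.1 h)
  have hq0 : ((Ideal.absNorm v.asIdeal : ℕ) : ℂ) ≠ 0 := by exact_mod_cast fun h => v.ne_bot (Ideal.absNorm_eq_zero_iff.1 h)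
  have hnq : ‖((Ideal.absNorm v.asIdeal : ℕ) : ℂ)‖ = ((Ideal.absNorm v.asIdeal : ℕ) : ℝ) := by rw [Complex.norm_natCast]
  -- `|z∕q| < 1`, `|z∕q²| < 1`, `|z²| < 1`, `|z| < 1` ⇒ the Macdonald factors are units
  have hsmall : ∀ t : ℂ, ‖t‖ < 1 → (1 + t ≠ 0 ∧ 1 - t ≠ 0) := fun t ht =>
    ⟨fun h => by rw [add_eq_zero_iff_eq_neg] at h; rw [← neg_neg t, ← h, norm_neg, norm_one] at ht; exact lt_irrefl _ ht,
     fun h => by rw [sub_eq_zero] at h; rw [← h, norm_one] at ht; exact lt_irrefl _ ht⟩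
  have hzq : ‖((χ₁ ϖ : ℂˣ) : ℂ) / ((Ideal.absNorm v.asIdeal : ℕ) : ℂ)‖ < 1 := by
    rw [norm_div, hnq]; exact (div_le_self (norm_nonneg _) hq1).trans_lt hz
  have hzq2 : ‖((χ₁ ϖ : ℂˣ) : ℂ) / ((Ideal.absNorm v.asIdeal : ℕ) : ℂ) ^ 2‖ < 1 := by
    rw [norm_div, norm_pow, hnq]; exact (div_le_self (norm_nonneg _) (one_le_pow₀ hq1)).trans_lt hz
  have hz2 : ‖((χ₁ ϖ : ℂˣ) : ℂ) ^ 2‖ < 1 := by rw [norm_pow]; exact pow_lt_one₀ (norm_nonneg _) hz two_ne_zero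
  have hM : (μ.real {u : ↥(cmBorelTriple L 3 v).N | (((∏ w' : PlacesOver L v, normAbs (w'.1.adicCompletion L) ((((((u : ↥(unitaryGroupOfForm (conjLocal L (IsCMField.complexConj L) v) (cmLocalForm L 3 v)))) : GL (Fin 3) (LocalRing L v)) : Matrix (Fin 3) (Fin 3) (LocalRing L v)) 0 2) w')) : ℝ≥0) : ℝ) ≤ 1} : ℂ) ≠ 0 := by exact_mod_cast (measureReal_heightBall_one_pos L v hns ϖ hϖ μ).ne'
  have hc0 : (J fK).toFun 1 ≠ 0 := by
    rw [hJK, Representation.SmoothInd.toFun_smul, Pi.smul_apply, hK'1, hK1, smul_eq_mul, mul_one, mul_one]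
    exact mul_ne_zero hM (mul_ne_zero (mul_ne_zero (hsmall _ hzq).1 (hsmall _ hzq2).2) (inv_ne_zero (hsmall _ hz2).2))
  rw [reducible_iff_forall_eval_mul_eval_eq_zero L v hns χ₁ χ₂ h₁ h₂ hreg fK hfK hK1 fK' hfK' hK'1]
  exact ⟨fun h B => (mul_eq_zero.1 (h J B)).resolve_left hc0, fun h A B => by rw [h B, mul_zero]⟩

set_option synthInstance.maxHeartbeats 400000 in
set_option maxHeartbeats 8000000 in
-- statement∕proof over two `SmoothInd` carriers of ★ `cmPrincipalSeries` (class of ★ `K2E3SphericalCFunctionMacdonald.exists_intertwiningIntegral_sphericalVector_eq_macdonald_smul`)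
/-- **THE JUNCTION, TAME-RAMIFIED PLACE.**  `v` non-split, tame-ramified place (`v ∤ 2`), `w₀` of matrix `Φ₃`, `μ` Haar on `N(L⁺_v)`, `ϖ` a uniformiser unit; `χ₁, χ₂` continuous, `χ₂(−1) = 1`, `χ₁ = 1` on `𝒪_vˣ`,
`|χ₁| = ‖·‖^s` with `s > 0` (so `χ` is regular and `|z| < 1`, `z = χ₁(ϖ)`); `f_K ∈ i(χ)^{K_v}`, `f'_K ∈ i(wχ)^{K_v}` with `f_K(1) = f'_K(1) = 1`.  Then
**`i_G(χ)` is reducible ⟺ `(B f'_K)(1) = 0` for every `G`-map `B : i(wχ) → i(χ)`**: in §2 take `A = J(w, χ)`, whose `(J f_K)(1) = c_w(χ)·μ(B₁)`-value is Macdonald's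
(★ `K2E3SphericalCFunctionMacdonald`), non-zero on `|z| < 1` (§3 `measureReal_heightBall_one_pos` and the explicit factors).  Keys' Theorem (2) on this line thus reads:
«`(B f'_K)(1) = 0` exactly when `χ₁ = ‖·‖_E` or `χ₁ = η‖·‖_E^{1∕2}` (`η(ϖ) = −1`)» — the counter-intertwiner on the spherical vector = the continued `c_w(wχ)`, an Iwahori-level number.
[cite: Casselman1995, Thm. 6.6.2 p. 66; §6.4] [cite: Keys1984, §7 Thm (2); §3] [cite: Rogawski1990, §4.5 p. 45; §12.2 p. 173] -/
theorem reducible_iff_forall_counterIntertwiner_eval_eq_zero_ramified (hns : ∀ w : PlacesOver L v, IsCMField.complexConj L • w.1 = w.1) (w : PlacesOver L v)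
    (he : v.asIdeal.ramificationIdx' w.1.asIdeal ≠ 1) (h2w : Valued.v (2 : w.1.adicCompletion L) = 1)
    (χ₁ : (LocalRing L v)ˣ →* ℂˣ) (χ₂ : ↥(normOneUnits (conjLocal L (IsCMField.complexConj L) v)) →* ℂˣ) (h₁ : Continuous fun x => ((χ₁ x : ℂˣ) : ℂ)) (h₂ : Continuous fun x => ((χ₂ x : ℂˣ) : ℂ)) (hχ₂ : χ₂ ⟨-1, F0P3cStCharTSBigCellFactorisation.neg_one_mem_normOneUnits (conjLocal L (IsCMField.complexConj L) v)⟩ = 1)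
    (hunr : ∀ u ∈ (Submonoid.pi Set.univ (fun w : PlacesOver L v => (w.1.adicCompletionIntegers L).toSubring.toSubmonoid)).units, χ₁ u = 1) {s : ℝ} (hs : 0 < s)
    (hχ₁ : ∀ x : (LocalRing L v)ˣ, ‖((χ₁ x : ℂˣ) : ℂ)‖ = ((unitModulusChar (LocalRing L v) x : ℝ≥0) : ℝ) ^ s)
    (ϖ : (LocalRing L v)ˣ) (hϖ : ∀ w : PlacesOver L v, Valued.v ((ϖ : LocalRing L v) w) = WithZero.exp (-1 : ℤ))
    (w₀ : ↥(unitaryGroupOfForm (conjLocal L (IsCMField.complexConj L) v) (cmLocalForm L 3 v))) (hw₀ : Units.val (w₀ : GL (Fin 3) (LocalRing L v)) = cmLocalForm L 3 v)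
    [MeasurableSpace ↥(cmBorelTriple L 3 v).N] [BorelSpace ↥(cmBorelTriple L 3 v).N] (μ : Measure ↥(cmBorelTriple L 3 v).N) [μ.IsHaarMeasure]
    (fK : haveI := locallyCompactSpace_cmBorelU L 3 v
      Representation.SmoothInd (cmBorelTriple L 3 v).P (Representation.twist (((Representation.trivial ℂ ↥(torusU (conjLocal L (IsCMField.complexConj L) v) (cmLocalForm L 3 v)) ℂ).twist
        (cmTorusCharPair L v χ₁ χ₂)).comp (cmBorelTriple L 3 v).proj) (rootDeltaChar (cmBorelTriple L 3 v).P)))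
    (hfK : haveI := locallyCompactSpace_cmBorelU L 3 v
      fK ∈ (Representation.smoothIndRep (cmBorelTriple L 3 v).P _).fixedPoints (cmLocalIntegralLevel L 3 (Matrix.of fun i j : Fin 3 => if i.val + j.val + 1 = 3 then (1 : L) else 0) v)) (hK1 : fK.toFun 1 = 1)
    (fK' : haveI := locallyCompactSpace_cmBorelU L 3 v
      Representation.SmoothInd (cmBorelTriple L 3 v).P (Representation.twist (((Representation.trivial ℂ ↥(torusU (conjLocal L (IsCMField.complexConj L) v) (cmLocalForm L 3 v)) ℂ).twist
        (cmTorusCharPair L v (conjInvChar (conjLocal L (IsCMField.complexConj L) v) χ₁) χ₂)).comp (cmBorelTriple L 3 v).proj) (rootDeltaChar (cmBorelTriple L 3 v).P)))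
    (hfK' : haveI := locallyCompactSpace_cmBorelU L 3 v
      fK' ∈ (Representation.smoothIndRep (cmBorelTriple L 3 v).P _).fixedPoints (cmLocalIntegralLevel L 3 (Matrix.of fun i j : Fin 3 => if i.val + j.val + 1 = 3 then (1 : L) else 0) v)) (hK'1 : fK'.toFun 1 = 1) :
    (∃ N : Subrepresentation (cmPrincipalSeries L 3 v (cmTorusCharPair L v χ₁ χ₂)), N ≠ ⊥ ∧ N ≠ ⊤) ↔
      ∀ (B : (cmPrincipalSeries L 3 v (cmTorusCharPair L v (conjInvChar (conjLocal L (IsCMField.complexConj L) v) χ₁) χ₂)).IntertwiningMap (cmPrincipalSeries L 3 v (cmTorusCharPair L v χ₁ χ₂))), (B fK').toFun 1 = 0 := by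
  have ha0 : 0 < ((unitModulusChar (LocalRing L v) ϖ : ℝ≥0) : ℝ) := NNReal.coe_pos.2 distribHaarChar_pos
  have ha1 : ((unitModulusChar (LocalRing L v) ϖ : ℝ≥0) : ℝ) < 1 := by exact_mod_cast K2E3SphericalCFunctionShellExpansion.unitModulusChar_uniformizer_lt_one L v hns ϖ hϖ
  have hz : ‖((χ₁ ϖ : ℂˣ) : ℂ)‖ < 1 := by rw [hχ₁ ϖ]; exact Real.rpow_lt_one ha0.le ha1 hs
  have hreg := K2E3NonUnitaryCharacterDichotomy.cmTorusCharPair_ne_weyl_of_exists_norm_ne_one L v hns χ₁ χ₂ h₁ ⟨ϖ, hz.ne⟩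
  -- the intertwining integral and its Macdonald value on `f_K`
  obtain ⟨J, -, -, hJK⟩ := K2E3SphericalCFunctionMacdonald.exists_intertwiningIntegral_sphericalVector_eq_macdonald_ramified_smul L v hns w he h2w χ₁ χ₂ h₁ h₂ hχ₂ hunr hs hχ₁
    ϖ hϖ w₀ hw₀ μ fK hfK fK' hfK' hK'1
  have hq1 : (1 : ℝ) ≤ ((Ideal.absNorm v.asIdeal : ℕ) : ℝ) := by exact_mod_cast Nat.one_le_iff_ne_zero.2 fun h => v.ne_bot (Ideal.absNorm_eq_zero_iff.1 h)
  have hq0 : ((Ideal.absNorm v.asIdeal : ℕ) : ℂ) ≠ 0 := by exact_mod_cast fun h => v.ne_bot (Ideal.absNorm_eq_zero_iff.1 h)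
  have hnq : ‖((Ideal.absNorm v.asIdeal : ℕ) : ℂ)‖ = ((Ideal.absNorm v.asIdeal : ℕ) : ℝ) := by rw [Complex.norm_natCast]
  -- `|z∕q| < 1`, `|z∕q²| < 1`, `|z²| < 1`, `|z| < 1` ⇒ the Macdonald factors are units
  have hsmall : ∀ t : ℂ, ‖t‖ < 1 → (1 + t ≠ 0 ∧ 1 - t ≠ 0) := fun t ht =>
    ⟨fun h => by rw [add_eq_zero_iff_eq_neg] at h; rw [← neg_neg t, ← h, norm_neg, norm_one] at ht; exact lt_irrefl _ ht,
     fun h => by rw [sub_eq_zero] at h; rw [← h, norm_one] at ht; exact lt_irrefl _ ht⟩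
  have hzq : ‖((χ₁ ϖ : ℂˣ) : ℂ) / ((Ideal.absNorm v.asIdeal : ℕ) : ℂ)‖ < 1 := by
    rw [norm_div, hnq]; exact (div_le_self (norm_nonneg _) hq1).trans_lt hz
  have hzq2 : ‖((χ₁ ϖ : ℂˣ) : ℂ) / ((Ideal.absNorm v.asIdeal : ℕ) : ℂ) ^ 2‖ < 1 := by
    rw [norm_div, norm_pow, hnq]; exact (div_le_self (norm_nonneg _) (one_le_pow₀ hq1)).trans_lt hz
  have hz2 : ‖((χ₁ ϖ : ℂˣ) : ℂ) ^ 2‖ < 1 := by rw [norm_pow]; exact pow_lt_one₀ (norm_nonneg _) hz two_ne_zero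
  have hM : (μ.real {u : ↥(cmBorelTriple L 3 v).N | (((∏ w' : PlacesOver L v, normAbs (w'.1.adicCompletion L) ((((((u : ↥(unitaryGroupOfForm (conjLocal L (IsCMField.complexConj L) v) (cmLocalForm L 3 v)))) : GL (Fin 3) (LocalRing L v)) : Matrix (Fin 3) (Fin 3) (LocalRing L v)) 0 2) w')) : ℝ≥0) : ℝ) ≤ 1} : ℂ) ≠ 0 := by exact_mod_cast (measureReal_heightBall_one_pos L v hns ϖ hϖ μ).ne'
  have hc0 : (J fK).toFun 1 ≠ 0 := by
    rw [hJK, Representation.SmoothInd.toFun_smul, Pi.smul_apply, hK'1, hK1, smul_eq_mul, mul_one, mul_one]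
    exact mul_ne_zero hM (mul_ne_zero (hsmall _ hzq).2 (inv_ne_zero (hsmall _ hz).2))
  rw [reducible_iff_forall_eval_mul_eval_eq_zero L v hns χ₁ χ₂ h₁ h₂ hreg fK hfK hK1 fK' hfK' hK'1]
  exact ⟨fun h B => (mul_eq_zero.1 (h J B)).resolve_left hc0, fun h A B => by rw [h B, mul_zero]⟩

end Summit.HodgeConjecture.HodgeConjecture.Cruxes.H413.K2E3SphericalReducibilityJunction

end
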